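import Summits.QuantumFields.YangMills.Theorems.ComplexCouplingChannelComplexStrongCouplingAnchor
import Summits.QuantumFields.YangMills.Theorems.ComplexCouplingChannelFreeEnergyWindowChannelStubChainOnCompacts
import Summits.QuantumFields.YangMills.Theorems.ComplexCouplingChannelFreeEnergyWindowChannelStubWindowOnCompacts
import Summits.QuantumFields.YangMills.Theorems.ComplexCouplingChannelFreeEnergyWindowChannelStubConnectedCompactJoin
import Literature.MathematicalPhysics.QuantumFieldTheory.WilsonFinTorusPartitionComplex

/-!
# Line `Sketch` (idea `upper-envelope-suffices`) for crux `FreeEnergyWindowChannel` (stmt-QuantumFields-18842)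

Lead skeleton (prover-line-stmt-QuantumFields-18842-0, 2026-08-17; v2 — S2–S4 landed, only S1 open).

The crux (route `ComplexCouplingChannel`, rank 3): for every compact simple `G` and faithful unitary `r`,
beyond some `β₁`, every real coupling `β ≥ β₁` is joined to the strong-coupling anchor by an open connected
complex-coupling channel `D` on which the symmetric-torus Wilson partition functions
`Z_P(z) = Z(z; P, P) = wilsonFinTorusPartitionC r.ρ z P P P P` (`P ≥ P₀`) are zero-free with a BOUNDED
continuation of the finite-size free energy, `|log ‖Z_P z‖ + P⁴ Re f z| ≤ M`, one analytic `f` on `D`.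
The crux's inline `let Zc := …` is `fun z a t => wilsonFinTorusPartitionC r.ρ z a a a t` by `rfl`
(`wilsonFinTorusPartitionC_eq_inline`).

THE LINE.  The finite-size excess `u_P := log ‖Z_P‖ + P⁴ Re f` is (where `Z_P ≠ 0`) the log-modulus of the
holomorphic function `Z_P · exp (P⁴ f)`.  An UPPER bound `u_P ≤ M` on an anchor-connected channel (the
one-sided ENVELOPE `‖Z_P · exp (P⁴ f)‖ ≤ e^M`, which needs no zero-freeness to state), pinned to a two-sided
bound on one small ball at the anchor point `x`, already forces zero-freeness and the two-sided window with
`M = 1` on every compact subset of the channel, for `P` large: the PROVED anchor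
(`complexStrongCouplingAnchor_proof`, stmt-QuantumFields-18843) pins `Z_P e^{P⁴ f_A} = 1 + O(P⁴ e^{-cP})` on the
strong-coupling disc, and the two-constants estimate along disc chains (tree:
`exists_exponent_norm_le_rpow_mul_rpow`, pointwise; here needed uniformly on compacts) transports that
smallness through the channel against the envelope bound `e^M + 1`.  So the crux is EQUIVALENT (given the
anchor) to the one-sided statement `stub_upperEnvelope` (C⁺), and all physics sits there.

Stubs:
* `stub_upperEnvelope` (S1; physics; open-problem grade; the hardest, held by the lead): C⁺.
* `stub_chainOnCompacts` (S2; one complex variable; provable, size M): the disc-chain two-constants estimate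
  with ONE exponent `θ` valid on a whole compact `K ⊆ D` (the tree theorem gives `θ` at one point).
* `stub_windowOnCompacts` (S3; one complex variable; provable, size L): pinning + envelope ⇒ zero-free
  two-sided window (`M = 1`) on every compact `K ⊆ D` for `P ≥ P₁(K)`; the chain property of `D` (shape of
  S2's conclusion) is a HYPOTHESIS, so S2 and S3 are independent.  Adaptation of the engine's torus leg
  `abs_log_norm_add_le_exp_neg_of_window` (holomorphic logarithm + Borel–Carathéodory on the disc,
  `Re f = Re f_A` near `x`, `h_P = Z_P e^{P⁴(f − iκ) − iP⁴ Im f_A 0} − 1`).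
* `stub_connectedCompactJoin` (S4; plane topology; provable, size S/M): two points of an open connected
  `D ⊆ ℂ` lie in an open connected `D'` with `D' ⊆ K ⊆ D`, `K` compact (thickened path).
`FreeEnergyWindowChannel_of` assembles S1–S4 with the proved anchor (sorry-free): feed C⁺ with
`ρ ⊓ ρ₀/2`, join `x` to `β` by S4, window on `K` by S3∘S2, restrict to `D'`.

Disproof used: none (no `Disproof.lean` for this crux is visible from this seat at v1).
-/

open MeasureTheory Complex Metric Set

namespace Summit.QuantumFields.YangMills.Cruxes.FreeEnergyWindowChannel.Sketch

/-- STUB S1 (physics; the transferred crux C⁺ = `UpperEnvelopeChannel`; difficulty: open-problem).  For every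
compact simple `G` and faithful unitary `r` there is `β₁` such that for every `β ≥ β₁` and `ρ > 0` there is an
open connected `D ∋ β` containing a real `x`, `|x| < ρ`, a holomorphic `f` on `D`, `M` and `P₀` with:
(pinning) on some ball around `x` inside `D` the symmetric-torus partition functions are zero-free with
`|log ‖Z_P‖ + P⁴ Re f| ≤ M` for `P ≥ P₀` (dischargeable from the anchor: it says `Re f = Re f_A` near `x`), and
(envelope) `‖Z_P(z) · exp (P⁴ f z)‖ ≤ e^M` for all `P ≥ P₀`, `z ∈ D` — the continued strong-coupling branch stays
dominant in modulus.  Trivially implied by the crux (same `D, f`); implies it by S2–S4 and the anchor. -/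
theorem stub_upperEnvelope :
    ∀ (G : Type) [Group G] [TopologicalSpace G] [IsTopologicalGroup G] [CompactSpace G] [MeasurableSpace G] [BorelSpace G], Literature.MathematicalPhysics.QuantumFieldTheory.IsCompactSimpleLieGroup G → ∀ r : Literature.MathematicalPhysics.QuantumFieldTheory.LatticeRep G,
    ∃ β₁ : ℝ, ∀ β : ℝ, β₁ ≤ β → ∀ ρ : ℝ, 0 < ρ →
      ∃ D : Set ℂ, IsOpen D ∧ IsConnected D ∧ (β : ℂ) ∈ D ∧
        ∃ x : ℝ, |x| < ρ ∧ (x : ℂ) ∈ D ∧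
        ∃ f : ℂ → ℂ, DifferentiableOn ℂ f D ∧ ∃ M : ℝ, ∃ P₀ : ℕ,
          (∃ δ : ℝ, 0 < δ ∧ Metric.ball (x : ℂ) δ ⊆ D ∧ ∀ P : ℕ, P₀ ≤ P → ∀ z ∈ Metric.ball (x : ℂ) δ,
            Literature.MathematicalPhysics.QuantumFieldTheory.wilsonFinTorusPartitionC r.ρ z P P P P ≠ 0 ∧
            |Real.log ‖Literature.MathematicalPhysics.QuantumFieldTheory.wilsonFinTorusPartitionC r.ρ z P P P P‖ +
              (P : ℝ) ^ 4 * (f z).re| ≤ M) ∧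
          ∀ P : ℕ, P₀ ≤ P → ∀ z ∈ D,
            ‖Literature.MathematicalPhysics.QuantumFieldTheory.wilsonFinTorusPartitionC r.ρ z P P P P *
              Complex.exp ((P : ℂ) ^ 4 * f z)‖ ≤ Real.exp M := by
  sorry

/-! STUBS S2–S4 LANDED (wave 1, 2026-08-17): `stub_chainOnCompacts` (p146686,
`Theorems/ComplexCouplingChannelFreeEnergyWindowChannelStubChainOnCompacts.lean`), `stub_windowOnCompacts` (p146776,
`…StubWindowOnCompacts.lean`), `stub_connectedCompactJoin` (p146690, `…StubConnectedCompactJoin.lean`), all in namespace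
`Summit.QuantumFields.YangMills.Theorems.FreeEnergyWindowChannel`; imported above and used by name below. -/

/-- COMPOSITION (sorry-free apart from the stubs it names): the four stubs imply the crux BY NAME.
`β₁(crux) := β₁(C⁺)`; for `β ≥ β₁` and `ρ > 0` feed C⁺ (`stub_upperEnvelope`) with `ρ ⊓ ρ₀/2` (`ρ₀` the radius of
the PROVED anchor `complexStrongCouplingAnchor_proof`), so that its real point `x` lies in the anchor disc; join `x`
to `β` inside the envelope channel `D` by an open connected `D' ⊆ K ⊆ D`, `K` compact (`stub_connectedCompactJoin`);
the window with `M = 1` holds on `K` for `P ≥ P₁` (`stub_windowOnCompacts`, whose chain hypothesis is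
`stub_chainOnCompacts` at `D, x`); restrict to `D'`.  The crux's `let Zc` is `wilsonFinTorusPartitionC r.ρ`
definitionally; `Z_P` is entire (`differentiable_wilsonFinTorusPartitionC`, second countability of `G` from the
faithful `r`) with `Z_P 0 = 1` (`wilsonFinTorusPartitionC_zero`). -/
theorem FreeEnergyWindowChannel_of :
    Summit.QuantumFields.YangMills.Theses.ComplexCouplingChannel.FreeEnergyWindowChannel := by
  have h1 := stub_upperEnvelope
  have h2 := Summit.QuantumFields.YangMills.Theorems.FreeEnergyWindowChannel.stub_chainOnCompacts
  have h3 := Summit.QuantumFields.YangMills.Theorems.FreeEnergyWindowChannel.stub_windowOnCompacts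
  have h4 := Summit.QuantumFields.YangMills.Theorems.FreeEnergyWindowChannel.stub_connectedCompactJoin
  intro G _ _ _ _ _ _ hG r Zc
  haveI : SecondCountableTopology G :=
    (r.continuous.isClosedEmbedding r.injective).isEmbedding.secondCountableTopology
  -- the proved anchor (torus clause)
  obtain ⟨ρ₀, hρ₀, c, hc, -, fA, hfA, C, hA⟩ :=
    Summit.QuantumFields.YangMills.Theorems.complexStrongCouplingAnchor_proof G hG r
  have hA' : ∀ P : ℕ, 1 ≤ P → ∀ z : ℂ, ‖z‖ < ρ₀ →
      Literature.MathematicalPhysics.QuantumFieldTheory.wilsonFinTorusPartitionC r.ρ z P P P P ≠ 0 ∧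
      |Real.log ‖Literature.MathematicalPhysics.QuantumFieldTheory.wilsonFinTorusPartitionC r.ρ z P P P P‖ +
        (P : ℝ) ^ 4 * (fA z).re| ≤ C * (P : ℝ) ^ 4 * Real.exp (-(c * P)) :=
    fun P hP z hz => hA P hP z hz
  -- entire, normalised partition functions
  have hZd : ∀ P : ℕ, Differentiable ℂ fun z : ℂ =>
      Literature.MathematicalPhysics.QuantumFieldTheory.wilsonFinTorusPartitionC r.ρ z P P P P := fun P =>
    Literature.MathematicalPhysics.QuantumFieldTheory.differentiable_wilsonFinTorusPartitionC r.ρ r.continuous P P P P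
  have hZ1 : ∀ P : ℕ, Literature.MathematicalPhysics.QuantumFieldTheory.wilsonFinTorusPartitionC r.ρ 0 P P P P = 1 :=
    fun P => Literature.MathematicalPhysics.QuantumFieldTheory.wilsonFinTorusPartitionC_zero r.ρ P P P P
  -- the upper envelope, fed with `ρ ⊓ ρ₀/2`
  obtain ⟨β₁, hβ₁⟩ := h1 G hG r
  refine ⟨β₁, fun β hβ ρ hρ => ?_⟩
  obtain ⟨D, hDo, hDc, hβD, x, hxρ, hxD, f, hf, M, P₀, hpin, henv⟩ :=
    hβ₁ β hβ (min ρ (ρ₀ / 2)) (lt_min hρ (half_pos hρ₀))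
  have hxρ' : |x| < ρ := lt_of_lt_of_le hxρ (min_le_left _ _)
  have hxρ₀ : ‖(x : ℂ)‖ < ρ₀ := by
    rw [Complex.norm_real, Real.norm_eq_abs]
    linarith [lt_of_lt_of_le hxρ (min_le_right _ _)]
  -- a compactly contained connected sub-channel through `x` and `β`
  obtain ⟨D', K, hD'o, hD'c, hK, hxD', hβD', hD'K, hKD⟩ := h4 D hDo hDc (x : ℂ) hxD (β : ℂ) hβD
  -- the window on `K`
  obtain ⟨P₁, hP₁⟩ := h3
    (fun P z => Literature.MathematicalPhysics.QuantumFieldTheory.wilsonFinTorusPartitionC r.ρ z P P P P)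
    ρ₀ c C hρ₀ hc (fun P => (hZd P).differentiableOn) hZ1 fA hfA hA' D hDo hDc
    (fun P => (hZd P).differentiableOn) (x : ℂ) hxρ₀ hxD
    (fun r₀ hr₀ K' hK' hK'D => h2 D hDo hDc.isPreconnected (x : ℂ) hxD r₀ hr₀ K' hK' hK'D)
    f hf M P₀ hpin henv K hK hKD
  refine ⟨D', hD'o, hD'c, hβD', ⟨x, hxρ', hxD'⟩, f, hf.mono (hD'K.trans hKD), 1, P₁, ?_⟩
  intro P hP z hz
  exact hP₁ P hP z (hD'K hz)

end Summit.QuantumFields.YangMills.Cruxes.FreeEnergyWindowChannel.Sketch
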